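import Summits.MatrixMultiplication.MatrixMultiplication.Theses.DefinableSTPPDichotomy

/-!
# MatrixMultiplication / DefinableSTPPDichotomy — `HexagonClearanceR`, the shadow bound

Route `DefinableSTPPDichotomy`, crux `HexagonClearanceR` (stmt-MatrixMultiplication-17884), line
`Sketch`, stub `stub_shadowBound_of_noLonely`.

Recurrence of definable translates ("no lonely generic point": for ring formulas `τ(w; y)`,
`α(v; y')`, in large characteristic, every point of `T = τ(F; y)` outside an exceptional set `E` of
size `O(|F|^{m-1})` has, for every large `A = α(F; y')`, some `a₀ ≠ a` in `A` with
`t + a − a₀ ∈ T`) implies the SHADOW BOUND for definable families satisfying the pairwise STPP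
clause: `Σ_{x : C₀ < |A_x|} |B_x||C_x| ≤ C₀·|F|^{m−1}`.

Mechanism (pattern `k = i` of the clause, "isolating translates"): for `b ∈ B_x, c ∈ C_x` and
`a₀ ≠ a ∈ A_x` the point `(b − c) + a − a₀` avoids the whole shadow `⋃_j (B_j − C_j)`; so every
point of the partial shadow over the big blocks is exceptional, and that partial shadow is a
packing of size `Σ |B_x||C_x|`.  The shadow and the blocks are themselves cut out by ring formulas
(`exists_shadowFormula`, `exists_blockFormula`), so the hypothesis applies to them.

All helper statements are inline (no definitions); helpers live in the sub-namespace
`…Theorems.HexagonClearanceR.ShadowBound`.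
-/

-- the tree's namespace `Summit.MatrixMultiplication.MatrixMultiplication.…` repeats a component by
-- design
set_option linter.dupNamespace false

namespace Summit.MatrixMultiplication.MatrixMultiplication.Theorems.HexagonClearanceR

namespace ShadowBound

open Finset

section Shadow

variable {H : Type*} [AddCommGroup H] {ι : Type*}

/-- **Isolating translates** (pattern `k = i` of the pairwise clause): for `b ∈ B_i`, `c ∈ C_i`
and `a₀ ≠ a` in `A_i`, the translate `(b − c) + a − a₀` lies in no class `B_j − C_j`. -/
theorem isolating_translates {I : Finset ι} {A B C : ι → Finset H}
    (h : ∀ i ∈ I, ∀ j ∈ I, ∀ k ∈ I, (i = j ∨ j = k ∨ k = i) →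
      ∀ s ∈ A k, ∀ s' ∈ A i, ∀ t ∈ B i, ∀ t' ∈ B j, ∀ u ∈ C j, ∀ u' ∈ C k,
        (s' - s) + (t' - t) + (u' - u) = 0 → i = j ∧ j = k ∧ s = s' ∧ t = t' ∧ u = u')
    {i : ι} (hi : i ∈ I) {b c a₀ a : H} (hb : b ∈ B i) (hc : c ∈ C i) (ha₀ : a₀ ∈ A i)
    (ha : a ∈ A i) (hne : a ≠ a₀) {j : ι} (hj : j ∈ I) {b' c' : H} (hb' : b' ∈ B j)
    (hc' : c' ∈ C j) : (b - c) + a - a₀ ≠ b' - c' := by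
  -- adapted from Cruxes/PairwiseCurvedTilingsLC/LonelyTranslates.lean (`isolating_translates`)
  intro he
  have h0 : (a₀ - a) + (b' - b) + (c - c') = 0 := by
    have : (a₀ - a) + (b' - b) + (c - c') = (b' - c') - ((b - c) + a - a₀) := by abel
    rw [this, he, sub_self]
  exact hne (h i hi j hj i hi (Or.inr (Or.inr rfl)) a ha a₀ ha₀ b hb b' hb' c' hc' c hc h0).2.2.1

/-- **Packing of the `B − C` shadow**: under the pairwise clause, if all `A_k ≠ ∅` then
`|⋃_k (B_k − C_k)| = Σ_k |B_k||C_k|` (the `k = i`, `s = s'` instances of the clause). -/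
theorem card_bcShadow [DecidableEq H] {I : Finset ι} {A B C : ι → Finset H}
    (h : ∀ i ∈ I, ∀ j ∈ I, ∀ k ∈ I, (i = j ∨ j = k ∨ k = i) →
      ∀ s ∈ A k, ∀ s' ∈ A i, ∀ t ∈ B i, ∀ t' ∈ B j, ∀ u ∈ C j, ∀ u' ∈ C k,
        (s' - s) + (t' - t) + (u' - u) = 0 → i = j ∧ j = k ∧ s = s' ∧ t = t' ∧ u = u')
    (hA : ∀ k ∈ I, (A k).Nonempty) :
    (I.biUnion fun k => image₂ (· - ·) (B k) (C k)).card = ∑ k ∈ I, (B k).card * (C k).card := by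
  -- adapted from Cruxes/PairwiseCurvedTilingsLC/LonelyTranslates.lean (`card_bcShadow`)
  rw [card_biUnion]
  · refine sum_congr rfl fun k hk => ?_
    rw [card_image₂_iff.2]
    intro ⟨b, c⟩ hbc ⟨b', c'⟩ hbc' heq
    simp only [Set.mem_prod, mem_coe] at hbc hbc'
    obtain ⟨a, ha⟩ := hA k hk
    have h0 : (a - a) + (b' - b) + (c - c') = 0 := by
      have : (a - a) + (b' - b) + (c - c') = (b' - c') - (b - c) := by abel
      rw [this]; exact sub_eq_zero.2 heq.symm
    obtain ⟨-, -, -, hbb, hcc⟩ :=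
      h k hk k hk k hk (Or.inl rfl) a ha a ha b hbc.1 b' hbc'.1 c' hbc'.2 c hbc.2 h0
    exact Prod.ext hbb hcc.symm
  · intro k hk l hl hkl
    rw [Function.onFun, disjoint_left]
    intro v hvk hvl
    simp only [mem_image₂] at hvk hvl
    obtain ⟨b, hb, c, hc, rfl⟩ := hvk
    obtain ⟨b', hb', c', hc', he⟩ := hvl
    obtain ⟨a, ha⟩ := hA k hk
    have h0 : (a - a) + (b' - b) + (c - c') = 0 := by
      have : (a - a) + (b' - b) + (c - c') = (b' - c') - (b - c) := by abel
      rw [this, he, sub_self]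
    exact hkl (h k hk l hl k hk (Or.inr (Or.inr rfl)) a ha a ha b hb b' hb' c' hc' c hc h0).1

/-- **From recurrence to the shadow bound** (combinatorial form).  Under the pairwise clause, if
every point `t` of the shadow `⋃_j (B_j − C_j)` outside `E` is recurrent for every block `A_x`
with `K < |A_x|` (some `a₀ ≠ a` in `A_x` with `t + a − a₀` again in the shadow), then
`Σ_{x : K < |A_x|} |B_x||C_x| ≤ |E|`: by `isolating_translates` no point `b − c` of a big block's
class is recurrent, so the partial shadow over the big blocks lies inside `E`, and it is a packing
(`card_bcShadow`). -/
theorem sum_card_mul_card_le_of_recurrent [DecidableEq H] {I : Finset ι} {A B C : ι → Finset H}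
    (h : ∀ i ∈ I, ∀ j ∈ I, ∀ k ∈ I, (i = j ∨ j = k ∨ k = i) →
      ∀ s ∈ A k, ∀ s' ∈ A i, ∀ t ∈ B i, ∀ t' ∈ B j, ∀ u ∈ C j, ∀ u' ∈ C k,
        (s' - s) + (t' - t) + (u' - u) = 0 → i = j ∧ j = k ∧ s = s' ∧ t = t' ∧ u = u')
    (E : Finset H) {K : ℕ}
    (hrec : ∀ x ∈ I, K < (A x).card → ∀ t ∈ I.biUnion (fun j => image₂ (· - ·) (B j) (C j)),
      t ∉ E → ∃ a₀ ∈ A x, ∃ a ∈ A x, a ≠ a₀ ∧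
        t + a - a₀ ∈ I.biUnion (fun j => image₂ (· - ·) (B j) (C j))) :
    ∑ x ∈ I.filter (fun x => K < (A x).card), (B x).card * (C x).card ≤ E.card := by
  -- adapted from Cruxes/PairwiseCurvedTilingsLC/LonelyTranslates.lean (`bcShadow_le_of_recurrence`)
  have hI₁I : I.filter (fun x => K < (A x).card) ⊆ I := filter_subset _ _
  have hA₁ : ∀ x ∈ I.filter (fun x => K < (A x).card), (A x).Nonempty := fun x hx =>
    card_pos.1 (lt_of_le_of_lt (Nat.zero_le _) (mem_filter.1 hx).2)
  -- the partial shadow over the big blocks is a packing of the right size, inside the full shadow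
  have hcard : ((I.filter (fun x => K < (A x).card)).biUnion
      fun j => image₂ (· - ·) (B j) (C j)).card =
        ∑ x ∈ I.filter (fun x => K < (A x).card), (B x).card * (C x).card :=
    card_bcShadow (fun i hi j hj k hk => h i (hI₁I hi) j (hI₁I hj) k (hI₁I hk)) hA₁
  have hsub : ((I.filter (fun x => K < (A x).card)).biUnion fun j => image₂ (· - ·) (B j) (C j))
      ⊆ I.biUnion fun j => image₂ (· - ·) (B j) (C j) :=
    biUnion_subset_biUnion_of_subset_left _ hI₁I
  rw [← hcard]
  -- every point of the partial shadow is exceptional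
  refine card_le_card fun t ht => ?_
  by_contra htE
  have ht' := ht
  simp only [mem_biUnion, mem_image₂] at ht'
  obtain ⟨x, hx, b, hb, c', hc', rfl⟩ := ht'
  obtain ⟨hxI, hxA⟩ := mem_filter.1 hx
  obtain ⟨a₀, ha₀, a, ha, hne, hmem⟩ := hrec x hxI hxA (b - c') (hsub ht) htE
  simp only [mem_biUnion, mem_image₂] at hmem
  obtain ⟨j, hj, b'', hb'', c'', hc'', he⟩ := hmem
  exact isolating_translates h hxI hb hc' ha₀ ha hne hj hb'' hc'' he.symm

end Shadow

section Formulas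

open FirstOrder FirstOrder.Language

/-- **The shadow is definable.**  For ring formulas `φ_I(x; y)`, `φ_B(x, b; y)`, `φ_C(x, c; y)`
there is a ring formula `τ(w; y)` (namely
`∃x ∃b ∃c, φ_I(x;y) ∧ φ_B(x,b;y) ∧ φ_C(x,c;y) ∧ ⋀_i w_i = b_i + (−c_i)`) which, in every
compatible field and for every parameter `y`, cuts out the shadow `⋃_{x ∈ I} (B_x − C_x)` of the
realised family. -/
theorem exists_shadowFormula (e m k : ℕ) (φI : Language.ring.Formula (Fin e ⊕ Fin k))
    (φB φC : Language.ring.Formula ((Fin e ⊕ Fin m) ⊕ Fin k)) :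
    ∃ τ : Language.ring.Formula (Fin m ⊕ Fin k),
      ∀ (F : Type) [Field F] [FirstOrder.Ring.CompatibleRing F] [DecidableEq (Fin m → F)]
        (y : Fin k → F) (I : Finset (Fin e → F)) (B C : (Fin e → F) → Finset (Fin m → F)),
        (∀ x, x ∈ I ↔ φI.Realize (Sum.elim x y)) →
        (∀ x v, v ∈ B x ↔ φB.Realize (Sum.elim (Sum.elim x v) y)) →
        (∀ x v, v ∈ C x ↔ φC.Realize (Sum.elim (Sum.elim x v) y)) →
        ∀ w, w ∈ I.biUnion (fun x => Finset.image₂ (· - ·) (B x) (C x)) ↔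
          τ.Realize (Sum.elim w y) := by
  -- adapted from Cruxes/PairwiseCurvedTilingsLC/LonelyTranslates.lean
  -- (`shadowFormula`, `mem_bcShadow_iff_realize`), the relabellings written inline
  refine ⟨Formula.iExs (Fin e ⊕ (Fin m ⊕ Fin m))
    (φI.relabel (Sum.elim (fun xi => Sum.inr (Sum.inl xi)) (fun yi => Sum.inl (Sum.inr yi))) ⊓
      φB.relabel (Sum.elim (Sum.elim (fun xi => Sum.inr (Sum.inl xi))
        (fun bi => Sum.inr (Sum.inr (Sum.inl bi)))) (fun yi => Sum.inl (Sum.inr yi))) ⊓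
      φC.relabel (Sum.elim (Sum.elim (fun xi => Sum.inr (Sum.inl xi))
        (fun ci => Sum.inr (Sum.inr (Sum.inr ci)))) (fun yi => Sum.inl (Sum.inr yi))) ⊓
      Formula.iInf fun i : Fin m =>
        Term.equal (Term.var (Sum.inl (Sum.inl i)))
          (Term.var (Sum.inr (Sum.inr (Sum.inl i))) +
            -Term.var (Sum.inr (Sum.inr (Sum.inr i))))), ?_⟩
  intro F _ _ _ y I B C hI hB hC w
  simp only [mem_biUnion, mem_image₂, Formula.realize_iExs, Formula.realize_inf,
    Formula.realize_relabel, Formula.realize_iInf, Formula.realize_equal, Term.realize_var,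
    Sum.elim_inl, Sum.elim_inr, FirstOrder.Ring.realize_add, FirstOrder.Ring.realize_neg]
  constructor
  · rintro ⟨x, hx, b, hb, c, hc, rfl⟩
    refine ⟨Sum.elim x (Sum.elim b c), ⟨⟨?_, ?_⟩, ?_⟩, ?_⟩
    · rw [hI] at hx
      convert hx using 2
      funext a; cases a <;> rfl
    · rw [hB] at hb
      convert hb using 2
      funext a; rcases a with (a | a) | a <;> rfl
    · rw [hC] at hc
      convert hc using 2
      funext a; rcases a with (a | a) | a <;> rfl
    · intro i
      simp [sub_eq_add_neg]
  · rintro ⟨g, ⟨⟨hx, hb⟩, hc⟩, hw⟩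
    refine ⟨g ∘ Sum.inl, ?_, g ∘ Sum.inr ∘ Sum.inl, ?_, g ∘ Sum.inr ∘ Sum.inr, ?_, ?_⟩
    · rw [hI]
      convert hx using 2
      funext a; cases a <;> rfl
    · rw [hB]
      convert hb using 2
      funext a; rcases a with (a | a) | a <;> rfl
    · rw [hC]
      convert hc using 2
      funext a; rcases a with (a | a) | a <;> rfl
    · funext i
      have := hw i
      simp only [Function.comp_apply, Pi.sub_apply]
      rw [this, sub_eq_add_neg]

/-- **The blocks are uniformly definable with appended parameters.**  For a ring formula
`φ_A(x, v; y)` there is a ring formula `α(v; z)` in `m + (e + k)` variables (a relabelling of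
`φ_A`) such that `α(v; Fin.append x y) ↔ φ_A(x, v; y)`; so `α` with parameters `Fin.append x y`
cuts out the block `A_x`. -/
theorem exists_blockFormula (e m k : ℕ) (φA : Language.ring.Formula ((Fin e ⊕ Fin m) ⊕ Fin k)) :
    ∃ α : Language.ring.Formula (Fin m ⊕ Fin (e + k)),
      ∀ (F : Type) [Field F] [FirstOrder.Ring.CompatibleRing F] (y : Fin k → F)
        (A : (Fin e → F) → Finset (Fin m → F)),
        (∀ x v, v ∈ A x ↔ φA.Realize (Sum.elim (Sum.elim x v) y)) →
        ∀ (x : Fin e → F) (v : Fin m → F), v ∈ A x ↔ α.Realize (Sum.elim v (Fin.append x y)) := by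
  -- adapted from Cruxes/PairwiseCurvedTilingsLC/LonelyTranslates.lean
  -- (`blockFormula`, `mem_block_iff_realize`), the relabelling written inline
  refine ⟨φA.relabel (Sum.elim (Sum.elim (fun xi => Sum.inr (Fin.castAdd k xi))
    (fun vi => Sum.inl vi)) (fun yi => Sum.inr (Fin.natAdd e yi))), ?_⟩
  intro F _ _ y A hA x v
  rw [hA, Formula.realize_relabel]
  refine Iff.of_eq (congrArg _ ?_)
  funext a
  rcases a with (a | a) | a
  · simp
  · simp
  · simp

end Formulas

end ShadowBound

open Finset

/-- Stub 3: recurrence of definable translates (no lonely generic point) gives the shadow bound, by the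
isolating-translates consequence of pattern `k = i` applied to the `B − C` shadow and a big block `A_x`. -/
theorem stub_shadowBound_of_noLonely
    (hN : (∀ (m n n' : ℕ) (τ : FirstOrder.Language.ring.Formula (Fin m ⊕ Fin n))
        (α : FirstOrder.Language.ring.Formula (Fin m ⊕ Fin n')),
        ∃ (K Q : ℕ) (C₀ : ℝ), ∀ (F : Type) [Field F] [Fintype F] [FirstOrder.Ring.CompatibleRing F],
        Q ≤ ringChar F → ∀ (y : Fin n → F), ∃ E : Finset (Fin m → F),
          (E.card : ℝ) ≤ C₀ * (Fintype.card F : ℝ) ^ ((m : ℝ) - 1) ∧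
          ∀ (y' : Fin n' → F) (T A : Finset (Fin m → F)),
            (∀ w, w ∈ T ↔ τ.Realize (Sum.elim w y)) →
            (∀ v, v ∈ A ↔ α.Realize (Sum.elim v y')) →
            K < A.card → ∀ t ∈ T, t ∉ E → ∃ a₀ ∈ A, ∃ a ∈ A, a ≠ a₀ ∧ t + a - a₀ ∈ T)) :
    (∀ (e m k : ℕ) (φI : FirstOrder.Language.ring.Formula (Fin e ⊕ Fin k))
        (φA φB φC : FirstOrder.Language.ring.Formula ((Fin e ⊕ Fin m) ⊕ Fin k)),
        ∃ (C₀ q₁ : ℕ), ∀ (F : Type) [Field F] [Fintype F] [FirstOrder.Ring.CompatibleRing F],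
        q₁ ≤ ringChar F → ∀ (y : Fin k → F) (I : Finset (Fin e → F))
          (A B C : (Fin e → F) → Finset (Fin m → F)),
          (∀ x, x ∈ I ↔ φI.Realize (Sum.elim x y)) →
          (∀ x v, v ∈ A x ↔ φA.Realize (Sum.elim (Sum.elim x v) y)) →
          (∀ x v, v ∈ B x ↔ φB.Realize (Sum.elim (Sum.elim x v) y)) →
          (∀ x v, v ∈ C x ↔ φC.Realize (Sum.elim (Sum.elim x v) y)) →
          (∀ i ∈ I, ∀ j ∈ I, ∀ k ∈ I, (i = j ∨ j = k ∨ k = i) → ∀ s ∈ A k, ∀ s' ∈ A i,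
            ∀ t ∈ B i, ∀ t' ∈ B j, ∀ u ∈ C j, ∀ u' ∈ C k,
            (s' - s) + (t' - t) + (u' - u) = 0 → i = j ∧ j = k ∧ s = s' ∧ t = t' ∧ u = u') →
          ∑ x ∈ I.filter (fun x => C₀ < (A x).card), ((B x).card : ℝ) * (C x).card
            ≤ C₀ * (Fintype.card F : ℝ) ^ ((m : ℝ) - 1)) := by
  intro e m k φI φA φB φC
  classical
  -- the shadow `⋃_x (B_x − C_x)` and the blocks `A_x` as realised ring formulas
  obtain ⟨τ, hτ⟩ := ShadowBound.exists_shadowFormula e m k φI φB φC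
  obtain ⟨α, hα⟩ := ShadowBound.exists_blockFormula e m k φA
  obtain ⟨K, Q, C₀, hKQ⟩ := hN m k (e + k) τ α
  refine ⟨max K ⌈max C₀ 0⌉₊, Q, ?_⟩
  intro F _ _ _ hchar y I A B C hI hA hB hC hcl
  obtain ⟨E, hE, hrec⟩ := hKQ F hchar y
  -- combinatorial shadow bound `Σ_{x : max K … < |A_x|} |B_x||C_x| ≤ |E|`
  have hsum : ∑ x ∈ I.filter (fun x => max K ⌈max C₀ 0⌉₊ < (A x).card),
      (B x).card * (C x).card ≤ E.card := by
    refine ShadowBound.sum_card_mul_card_le_of_recurrent hcl E ?_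
    intro x _ hKx t ht htE
    exact hrec (Fin.append x y) _ (A x) (hτ F y I B C hI hB hC) (hα F y A hA x)
      (lt_of_le_of_lt (le_max_left _ _) hKx) t ht htE
  have hC₀ : C₀ ≤ ((max K ⌈max C₀ 0⌉₊ : ℕ) : ℝ) :=
    calc C₀ ≤ max C₀ 0 := le_max_left _ _
      _ ≤ (⌈max C₀ 0⌉₊ : ℝ) := Nat.le_ceil _
      _ ≤ ((max K ⌈max C₀ 0⌉₊ : ℕ) : ℝ) := by exact_mod_cast le_max_right _ _
  calc ∑ x ∈ I.filter (fun x => max K ⌈max C₀ 0⌉₊ < (A x).card), ((B x).card : ℝ) * (C x).card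
      = ((∑ x ∈ I.filter (fun x => max K ⌈max C₀ 0⌉₊ < (A x).card),
          (B x).card * (C x).card : ℕ) : ℝ) := by push_cast; rfl
    _ ≤ E.card := by exact_mod_cast hsum
    _ ≤ C₀ * (Fintype.card F : ℝ) ^ ((m : ℝ) - 1) := hE
    _ ≤ ((max K ⌈max C₀ 0⌉₊ : ℕ) : ℝ) * (Fintype.card F : ℝ) ^ ((m : ℝ) - 1) :=
        mul_le_mul_of_nonneg_right hC₀ (Real.rpow_nonneg (Nat.cast_nonneg _) _)

end Summit.MatrixMultiplication.MatrixMultiplication.Theorems.HexagonClearanceR
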